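import Summits.PneNP.PneNP.Theses.SymmetryBudget
import Literature.Computability.Complexity.SymmetricCircuit
import Literature.Computability.Complexity.SymmetricDnf
import Literature.Combinatorics.SimpleGraph.ColourRefinement

/-!
# Calibration of the rigid-instance benchmark `SymmetryBudget.RigidBenchmark` (item stmt-PneNP-2149), I

Support item `RigidBenchmark` of route `PneNP/SymmetryBudget` reads: for every polynomial `p`,
for infinitely many `m`, NO fully `Sym(Fin m)`-symmetric threshold circuit with at most `p m`
gates agrees with 3-colourability of `Gr x` on every colour-refinement-discrete input `x`
(`Gr x = SimpleGraph.fromRel (x · · = true)`). The planner files it as CALIBRATION (equivalent to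
`NP ⊄ P/poly`), not as a target. This file records the elementary part of that calibration:

* `rigidBenchmark_iff` — the item over the tree's NAMED predicates: its inline `Sym m Set.univ C`
  is `C.IsSymmetricUnder Set.univ` (`SymmetricCircuit.lean`, by `Iff.rfl`) and its inline
  `Discrete m G` is `IsCRDiscrete G` (`ColourRefinement.lean`, `isCRDiscrete_iff`);
* `threeCol_invariant`, `hasSymCircuit_univ_threeCol` — NON-VACUITY: at every `m` the
  3-colourability indicator IS computed (on all inputs) by a fully symmetric `tcBasis`-circuit, of
  size `2^(m²) + m² + 1` (the symmetric DNF), so the item is a genuine SIZE lower bound and not an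
  artefact of the symmetry predicate;
* `rigidBenchmark_imp_allInputs` — the trivial sandwich: the benchmark implies the full-symmetry
  lower bound for 3-colourability on ALL inputs (the promise version is the stronger statement).
-/

-- `Summit.PneNP.PneNP.…` duplicates `PneNP` BY DESIGN (single-problem summit, D-0017); the Summits
-- library sets this option globally (lakefile), repeated here so a standalone `lean check` is warning-free.
set_option linter.dupNamespace false

namespace Summit.PneNP.PneNP.Theorems

open Literature.Computability.Complexity Literature.Combinatorics.SimpleGraph Filter
open Summit.PneNP.PneNP.Theses.SymmetryBudget (RigidBenchmark)
open scoped Classical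

/-- **`RigidBenchmark` over the named predicates.** The item is literally: for every polynomial
`p`, frequently in `m`, no `tcBasis`-circuit of size `≤ p m` that is symmetric under every
permutation of `Fin m` (`Circuit.IsSymmetricUnder Set.univ`) agrees with 3-colourability of
`Gr x` on all CR-discrete inputs (`IsCRDiscrete (Gr x)`). -/
theorem rigidBenchmark_iff :
    RigidBenchmark ↔ ∀ p : Polynomial ℕ, ∃ᶠ m in atTop, ¬ ∃ C : Circuit (Fin m × Fin m),
      C.IsOver tcBasis ∧ C.size ≤ p.eval m ∧ C.IsSymmetricUnder Set.univ ∧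
      ∀ x : Fin m × Fin m → Bool,
        IsCRDiscrete (SimpleGraph.fromRel fun u v => x (u, v) = true : SimpleGraph (Fin m)) →
        C.eval x = decide ((SimpleGraph.fromRel fun u v => x (u, v) = true :
          SimpleGraph (Fin m)).Colorable 3) := by
  simp only [RigidBenchmark, isCRDiscrete_iff]
  exact Iff.rfl

/-- Reading a matrix through `ρ × ρ` pulls the graph `Gr x` back along `ρ`. -/
theorem fromRel_comp_perm {m : ℕ} (ρ : Equiv.Perm (Fin m)) (x : Fin m × Fin m → Bool) :
    (SimpleGraph.fromRel fun u v => x (ρ u, ρ v) = true : SimpleGraph (Fin m)) =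
      (SimpleGraph.fromRel fun u v => x (u, v) = true : SimpleGraph (Fin m)).comap ρ := by
  ext u v
  simp [SimpleGraph.fromRel_adj, ρ.injective.ne_iff]

/-- **The 3-colourability indicator is invariant** under relabelling the vertices (`Gr (x ∘ ρ×ρ)`
is isomorphic to `Gr x`). -/
theorem threeCol_invariant {m : ℕ} (ρ : Equiv.Perm (Fin m)) (x : Fin m × Fin m → Bool) :
    decide ((SimpleGraph.fromRel fun u v => x (ρ u, ρ v) = true : SimpleGraph (Fin m)).Colorable 3) =
      decide ((SimpleGraph.fromRel fun u v => x (u, v) = true : SimpleGraph (Fin m)).Colorable 3) := by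
  rw [fromRel_comp_perm]
  set G : SimpleGraph (Fin m) := SimpleGraph.fromRel fun u v => x (u, v) = true
  have e : G.comap ρ ≃g G := SimpleGraph.Iso.comap ρ G
  rw [decide_eq_decide]
  exact ⟨fun h => h.of_hom e.symm.toHom, fun h => h.of_hom e.toHom⟩

/-- **Non-vacuity of the benchmark.** At every `m`, 3-colourability of `Gr x` is computed on ALL
inputs by a `tcBasis`-circuit symmetric under EVERY permutation of `Fin m`, with at most
`2^(m²) + m² + 1` gates (the symmetric DNF of the invariant indicator). So in `RigidBenchmark`
only the size bound `p m` bites. -/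
theorem hasSymCircuit_univ_threeCol (m : ℕ) :
    HasSymCircuit tcBasis (Set.univ : Set (Equiv.Perm (Fin m))) (2 ^ (m * m) + m * m + 1)
      (fun x => decide ((SimpleGraph.fromRel fun u v => x (u, v) = true :
        SimpleGraph (Fin m)).Colorable 3)) :=
  hasSymCircuit_of_invariant _ _ fun ρ _ x => threeCol_invariant ρ x

/-- **The trivial sandwich.** `RigidBenchmark` implies the full-symmetry lower bound for
3-colourability on ALL inputs: for every polynomial `p`, frequently no fully symmetric
`tcBasis`-circuit of size `≤ p m` computes the 3-colourability indicator (a circuit correct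
everywhere is correct on the CR-discrete inputs). -/
theorem rigidBenchmark_imp_allInputs (h : RigidBenchmark) (p : Polynomial ℕ) :
    ∃ᶠ m in atTop, ¬ HasSymCircuit tcBasis (Set.univ : Set (Equiv.Perm (Fin m))) (p.eval m)
      (fun x => decide ((SimpleGraph.fromRel fun u v => x (u, v) = true :
        SimpleGraph (Fin m)).Colorable 3)) := by
  refine ((rigidBenchmark_iff.1 h) p).mono fun m hm hC => hm ?_
  obtain ⟨C, hB, hs, hS, hc⟩ := hC
  exact ⟨C, hB, hs, hS, fun x _ => hc x⟩

end Summit.PneNP.PneNP.Theorems
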